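import Mathlib
import Summits.ValiantsHypothesis.ValiantsHypothesis.Theorems.ProofCarryingSymmetryRestorationQPConstNormNF
import Summits.ValiantsHypothesis.ValiantsHypothesis.Theorems.ProofCarryingSymmetryRestorationQPACSums
import Summits.ValiantsHypothesis.ValiantsHypothesis.Theorems.ProofCarryingSymmetryRestorationQPDistEq

/-!
# Route ProofCarryingSymmetry — crux `RestorationQP`, line `registered`, rung S3⁗ under stub S2″ (`stub_proofsToACEquiv`), part 5:
the constant-folding normaliser respects everything but distributivity

Continuation of parts 1–4 (`UCEq`; `acEq_of_addArgs_perm`; `sadd`, `smul`, `cnorm`; `NF`).  On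
normal forms the smart sum and product are an AC-calculus absorbing units and constants:

* CONGRUENCE (`sadd_congr`, `smul_congr`): AC-equivalent normal forms have the same constant part and
  AC-equivalent non-constant parts (`asplit_rel`, `msplit_rel` — the constant is pinned to the right
  child of the root, and the pure parts have the same multiset of classes of flattened summands,
  whence are AC-equivalent by `acEq_of_addArgs_perm`);
* commutativity and associativity up to AC (`acEq_sadd_comm/assoc`, `acEq_smul_comm/assoc`), the
  unit laws (`sadd_const_zero`, `smul_const_zero`, `smul_const_one`) and the constant equations
  (`sadd_const_const`, `smul_const_const`) on the nose;
* THE KEY LEMMA **`acEq_cnorm_of_ucEq`**: `UCEq F G → ACEq (cnorm F) (cnorm G)` over constants with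
  `0 ≠ 1` (induction on `UCEq`), and the registered helper `proofsToACEquiv_aux_constNorm`.

Everything is elementary and proved; no named facts.
-/

-- single-problem summit: `Summit.ValiantsHypothesis.ValiantsHypothesis.…` is the namespace by design (D-0017)
set_option linter.dupNamespace false

noncomputable section

open scoped Classical

namespace Summit.ValiantsHypothesis.ValiantsHypothesis.Theorems

namespace ACStability

open Literature.Computability.AlgebraicComplexity ACClass

universe u v

variable {𝔽 : Type u} {X : Type v}

/-! ### AC-related optional parts -/

/-- Optional parts are related if both are absent, or both present and AC-equivalent. [folklore] -/
def ORel : Option (PIFormula 𝔽 X) → Option (PIFormula 𝔽 X) → Prop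
  | none, none => True
  | some p, some p' => ACEq p p'
  | _, _ => False

/-- `ORel` is reflexive. [folklore] -/
theorem orel_refl : ∀ x : Option (PIFormula 𝔽 X), ORel x x
  | none => trivial
  | some p => ACEq.refl p

/-- Merging respects `ORel`. [folklore] -/
theorem orel_amerge : ∀ {x x' y y' : Option (PIFormula 𝔽 X)},
    ORel x x' → ORel y y' → ORel (amerge x y) (amerge x' y')
  | none, none, _, _, _, hy => hy
  | some _, some _, none, none, hx, _ => hx
  | some _, some _, some _, some _, hx, hy => ACEq.add_congr hx hy
  | none, some _, _, _, hx, _ => False.elim hx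
  | some _, none, _, _, hx, _ => False.elim hx
  | some _, some _, none, some _, _, hy => False.elim hy
  | some _, some _, some _, none, _, hy => False.elim hy

/-- Merging respects `ORel`. [folklore] -/
theorem orel_mmerge : ∀ {x x' y y' : Option (PIFormula 𝔽 X)},
    ORel x x' → ORel y y' → ORel (mmerge x y) (mmerge x' y')
  | none, none, _, _, _, hy => hy
  | some _, some _, none, none, hx, _ => hx
  | some _, some _, some _, some _, hx, hy => ACEq.mul_congr hx hy
  | none, some _, _, _, hx, _ => False.elim hx
  | some _, none, _, _, hx, _ => False.elim hx
  | some _, some _, none, some _, _, hy => False.elim hy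
  | some _, some _, some _, none, _, hy => False.elim hy

/-- Merging is commutative up to AC. [folklore] -/
theorem orel_amerge_comm : ∀ x y : Option (PIFormula 𝔽 X), ORel (amerge x y) (amerge y x)
  | none, none => trivial
  | none, some q => ACEq.refl q
  | some p, none => ACEq.refl p
  | some p, some q => ACEq.add_comm p q

/-- Merging is commutative up to AC. [folklore] -/
theorem orel_mmerge_comm : ∀ x y : Option (PIFormula 𝔽 X), ORel (mmerge x y) (mmerge y x)
  | none, none => trivial
  | none, some q => ACEq.refl q
  | some p, none => ACEq.refl p
  | some p, some q => ACEq.mul_comm p q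

/-- Merging is associative up to AC. [folklore] -/
theorem orel_amerge_assoc : ∀ x y z : Option (PIFormula 𝔽 X),
    ORel (amerge x (amerge y z)) (amerge (amerge x y) z)
  | none, _, _ => orel_refl _
  | some _, none, _ => orel_refl _
  | some _, some _, none => ACEq.refl _
  | some p, some q, some r => ACEq.add_assoc p q r

/-- Merging is associative up to AC. [folklore] -/
theorem orel_mmerge_assoc : ∀ x y z : Option (PIFormula 𝔽 X),
    ORel (mmerge x (mmerge y z)) (mmerge (mmerge x y) z)
  | none, _, _ => orel_refl _
  | some _, none, _ => orel_refl _
  | some _, some _, none => ACEq.refl _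
  | some p, some q, some r => ACEq.mul_assoc p q r

/-- `none` is a right unit for merging. [folklore] -/
theorem amerge_none_right : ∀ x : Option (PIFormula 𝔽 X), amerge x none = x
  | none => rfl
  | some _ => rfl

/-- `none` is a right unit for merging. [folklore] -/
theorem mmerge_none_right : ∀ x : Option (PIFormula 𝔽 X), mmerge x none = x
  | none => rfl
  | some _ => rfl

/-- AC-equivalent formulas have the same classes of flattened summands, as lists up to
permutation. [folklore] -/
theorem ACEq.addArgs_perm {F G : PIFormula 𝔽 X} (h : ACEq F G) :
    ((addArgs F).map mk).Perm ((addArgs G).map mk) :=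
  Multiset.coe_eq_coe.1 h.addArgs_map_mk_eq

/-- AC-equivalent formulas have the same classes of flattened factors, as lists up to
permutation. [folklore] -/
theorem ACEq.mulArgs_perm {F G : PIFormula 𝔽 X} (h : ACEq F G) :
    ((mulArgs F).map mk).Perm ((mulArgs G).map mk) :=
  Multiset.coe_eq_coe.1 h.mulArgs_map_mk_eq

section Calculus

variable [CommSemiring 𝔽]

/-- Reassembling respects `ORel`. [folklore] -/
theorem acEq_amk : ∀ {m m' : Option (PIFormula 𝔽 X)}, ORel m m' → ∀ c : 𝔽, ACEq (amk m c) (amk m' c)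
  | none, none, _, _ => .refl _
  | some p, some p', h, c => by
    by_cases hc : c = 0
    · subst hc; rw [amk_some_zero, amk_some_zero]; exact h
    · rw [amk_some_of_ne p hc, amk_some_of_ne p' hc]; exact ACEq.add_congr h (.refl _)
  | none, some _, h, _ => False.elim h
  | some _, none, h, _ => False.elim h

/-- Reassembling respects `ORel`. [folklore] -/
theorem acEq_mmk : ∀ {m m' : Option (PIFormula 𝔽 X)}, ORel m m' → ∀ c : 𝔽, ACEq (mmk m c) (mmk m' c)
  | none, none, _, _ => .refl _
  | some p, some p', h, c => by
    by_cases hc : c = 1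
    · subst hc; rw [mmk_some_one, mmk_some_one]; exact h
    · rw [mmk_some_of_ne p hc, mmk_some_of_ne p' hc]; exact ACEq.mul_congr h (.refl _)
  | none, some _, h, _ => False.elim h
  | some _, none, h, _ => False.elim h

/-- Unfolding of the smart sum. [folklore] -/
theorem sadd_def (a b : PIFormula 𝔽 X) :
    sadd a b = amk (amerge (asplit a).1 (asplit b).1) ((asplit a).2 + (asplit b).2) := rfl

/-- Unfolding of the smart product. [folklore] -/
theorem smul_def (a b : PIFormula 𝔽 X) :
    smul a b = if (msplit a).2 * (msplit b).2 = 0 then .const 0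
      else mmk (mmerge (msplit a).1 (msplit b).1) ((msplit a).2 * (msplit b).2) := rfl

/-! ### Congruence -/

/-- **AC-equivalent normal forms have the same constant summand and AC-equivalent non-constant
summands.** [folklore] -/
theorem asplit_rel {a a' : PIFormula 𝔽 X} (ha : NF a) (ha' : NF a') (e : ACEq a a') :
    (asplit a).2 = (asplit a').2 ∧ ORel (asplit a).1 (asplit a').1 := by
  have hp := e.addArgs_perm
  rcases ha.ashape with ⟨k, rfl⟩ | hA | ⟨p, k, rfl, -, hp0⟩
  · cases e.eq_of_const
    exact ⟨rfl, trivial⟩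
  · rcases ha'.ashape with ⟨k', rfl⟩ | hA' | ⟨p', k', rfl, -, hp0'⟩
    · exact absurd (e.symm.eq_of_const ▸ hA) (not_apure_const k')
    · rw [hA.asplit_eq, hA'.asplit_eq]
      exact ⟨rfl, e⟩
    · exact absurd (hp.symm.subset (by simp [addArgs])) (hA.mk_const_not_mem k')
  · rcases ha'.ashape with ⟨k', rfl⟩ | hA' | ⟨p', k', rfl, -, hp0'⟩
    · exact absurd e.symm.eq_of_const (by simp)
    · exact absurd (hp.subset (by simp [addArgs])) (hA'.mk_const_not_mem k)
    · have hmem : mk (.const k) ∈ (addArgs (.add p' (.const k'))).map mk :=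
        hp.subset (by simp [addArgs])
      simp only [addArgs, List.map_append, List.map_cons, List.map_nil, List.mem_append,
        List.mem_singleton] at hmem
      rcases hmem with hmem | hmem
      · exact absurd hmem (hp0'.mk_const_not_mem k)
      · have hkk : (PIFormula.const k' : PIFormula 𝔽 X) = .const k := (mk_eq_mk.1 hmem).eq_of_const
        rw [hkk]
        refine ⟨rfl, ?_⟩
        simp only [asplit_add_const]
        have hp' : ((addArgs p).map mk ++ [mk (.const k)]).Perm ((addArgs p').map mk ++ [mk (.const k)]) := by
          simpa [addArgs, hkk] using hp
        exact acEq_of_addArgs_perm ((List.perm_append_right_iff _).1 hp')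

/-- **AC-equivalent normal forms have the same constant factor and AC-equivalent non-constant
factors.** [folklore] -/
theorem msplit_rel {a a' : PIFormula 𝔽 X} (ha : NF a) (ha' : NF a') (e : ACEq a a') :
    (msplit a).2 = (msplit a').2 ∧ ORel (msplit a).1 (msplit a').1 := by
  have hp := e.mulArgs_perm
  rcases ha.mshape with ⟨k, rfl⟩ | hA | ⟨p, k, rfl, -, -, hp0⟩
  · cases e.eq_of_const
    exact ⟨rfl, trivial⟩
  · rcases ha'.mshape with ⟨k', rfl⟩ | hA' | ⟨p', k', rfl, -, -, hp0'⟩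
    · exact absurd (e.symm.eq_of_const ▸ hA) (not_mpure_const k')
    · rw [hA.msplit_eq, hA'.msplit_eq]
      exact ⟨rfl, e⟩
    · exact absurd (hp.symm.subset (by simp [mulArgs])) (hA.mk_const_not_mem k')
  · rcases ha'.mshape with ⟨k', rfl⟩ | hA' | ⟨p', k', rfl, -, -, hp0'⟩
    · exact absurd e.symm.eq_of_const (by simp)
    · exact absurd (hp.subset (by simp [mulArgs])) (hA'.mk_const_not_mem k)
    · have hmem : mk (.const k) ∈ (mulArgs (.mul p' (.const k'))).map mk :=
        hp.subset (by simp [mulArgs])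
      simp only [mulArgs, List.map_append, List.map_cons, List.map_nil, List.mem_append,
        List.mem_singleton] at hmem
      rcases hmem with hmem | hmem
      · exact absurd hmem (hp0'.mk_const_not_mem k)
      · have hkk : (PIFormula.const k' : PIFormula 𝔽 X) = .const k := (mk_eq_mk.1 hmem).eq_of_const
        rw [hkk]
        refine ⟨rfl, ?_⟩
        simp only [msplit_mul_const]
        have hp' : ((mulArgs p).map mk ++ [mk (.const k)]).Perm ((mulArgs p').map mk ++ [mk (.const k)]) := by
          simpa [mulArgs, hkk] using hp
        exact acEq_of_mulArgs_perm ((List.perm_append_right_iff _).1 hp')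

/-- **The smart sum respects AC-equivalence of normal forms.** [folklore] -/
theorem sadd_congr {a a' b b' : PIFormula 𝔽 X} (ha : NF a) (ha' : NF a') (hb : NF b) (hb' : NF b')
    (e₁ : ACEq a a') (e₂ : ACEq b b') : ACEq (sadd a b) (sadd a' b') := by
  obtain ⟨hc₁, hr₁⟩ := asplit_rel ha ha' e₁
  obtain ⟨hc₂, hr₂⟩ := asplit_rel hb hb' e₂
  rw [sadd_def, sadd_def, hc₁, hc₂]
  exact acEq_amk (orel_amerge hr₁ hr₂) _

/-- **The smart product respects AC-equivalence of normal forms.** [folklore] -/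
theorem smul_congr {a a' b b' : PIFormula 𝔽 X} (ha : NF a) (ha' : NF a') (hb : NF b) (hb' : NF b')
    (e₁ : ACEq a a') (e₂ : ACEq b b') : ACEq (smul a b) (smul a' b') := by
  obtain ⟨hc₁, hr₁⟩ := msplit_rel ha ha' e₁
  obtain ⟨hc₂, hr₂⟩ := msplit_rel hb hb' e₂
  rw [smul_def, smul_def, hc₁, hc₂]
  split_ifs
  · exact .refl _
  · exact acEq_mmk (orel_mmerge hr₁ hr₂) _

/-! ### Commutativity, associativity, units, constants -/

/-- The smart sum is commutative up to AC. [folklore] -/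
theorem acEq_sadd_comm (a b : PIFormula 𝔽 X) : ACEq (sadd a b) (sadd b a) := by
  rw [sadd_def, sadd_def, add_comm (asplit b).2]
  exact acEq_amk (orel_amerge_comm _ _) _

/-- The smart product is commutative up to AC. [folklore] -/
theorem acEq_smul_comm (a b : PIFormula 𝔽 X) : ACEq (smul a b) (smul b a) := by
  rw [smul_def, smul_def, mul_comm (msplit b).2]
  split_ifs
  · exact .refl _
  · exact acEq_mmk (orel_mmerge_comm _ _) _

/-- The smart sum is associative up to AC on normal forms. [folklore] -/
theorem acEq_sadd_assoc {a b c : PIFormula 𝔽 X} (ha : NF a) (hb : NF b) (hc : NF c) :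
    ACEq (sadd a (sadd b c)) (sadd (sadd a b) c) := by
  rw [sadd_def a (sadd b c), sadd_def (sadd a b) c, asplit_sadd hb hc, asplit_sadd ha hb]
  dsimp only
  rw [add_assoc]
  exact acEq_amk (orel_amerge_assoc _ _ _) _

/-- The smart product is associative up to AC on normal forms. [folklore] -/
theorem acEq_smul_assoc {a b c : PIFormula 𝔽 X} (ha : NF a) (hb : NF b) (hc : NF c) :
    ACEq (smul a (smul b c)) (smul (smul a b) c) := by
  rw [smul_def a (smul b c), smul_def (smul a b) c, msplit_smul_snd hb hc, msplit_smul_snd ha hb,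
    mul_assoc]
  by_cases h : (msplit a).2 * ((msplit b).2 * (msplit c).2) = 0
  · rw [if_pos h, if_pos h]
    exact .refl _
  · have hbc : (msplit b).2 * (msplit c).2 ≠ 0 := fun h0 => h (by rw [h0, mul_zero])
    have hab : (msplit a).2 * (msplit b).2 ≠ 0 := fun h0 => h (by rw [← mul_assoc, h0, zero_mul])
    rw [if_neg h, if_neg h, msplit_smul_fst hb hc hbc, msplit_smul_fst ha hb hab]
    exact acEq_mmk (orel_mmerge_assoc _ _ _) _

/-- A7 on normal forms: `a + 0 ↦ a`. [folklore] -/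
theorem sadd_const_zero {a : PIFormula 𝔽 X} (ha : NF a) : sadd a (.const 0) = a := by
  rw [sadd_def, asplit_const]
  dsimp only
  rw [add_zero, amerge_none_right, ha.amk_asplit]

/-- A8: `a · 0 ↦ 0`. [folklore] -/
theorem smul_const_zero (a : PIFormula 𝔽 X) : smul a (.const 0) = .const 0 := by
  rw [smul_def, msplit_const]
  dsimp only
  rw [mul_zero, if_pos rfl]

/-- A9 on normal forms: `a · 1 ↦ a` (over `0 ≠ 1`). [folklore] -/
theorem smul_const_one [Nontrivial 𝔽] {a : PIFormula 𝔽 X} (ha : NF a) : smul a (.const 1) = a := by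
  rw [smul_def, msplit_const]
  dsimp only
  rw [mul_one]
  by_cases h0 : (msplit a).2 = 0
  · rw [if_pos h0, ha.eq_const_zero_of_msplit h0]
  · rw [if_neg h0, mmerge_none_right, ha.mmk_msplit]

/-- A10, additive: constants are added. [folklore] -/
theorem sadd_const_const (b c : 𝔽) : sadd (.const b : PIFormula 𝔽 X) (.const c) = .const (b + c) := rfl

/-- A10, multiplicative: constants are multiplied. [folklore] -/
theorem smul_const_const (b c : 𝔽) : smul (.const b : PIFormula 𝔽 X) (.const c) = .const (b * c) := by
  rw [smul_def, msplit_const, msplit_const]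
  dsimp only
  split_ifs with h
  · rw [h]
  · rfl

/-! ### The key lemma -/

/-- **The key lemma.** Formulas equal modulo associativity, commutativity, the unit laws and the
constant equations have AC-equivalent constant-folding normal forms (over constants with `0 ≠ 1`).
[folklore] -/
theorem acEq_cnorm_of_ucEq [Nontrivial 𝔽] {F G : PIFormula 𝔽 X} (h : UCEq F G) :
    ACEq (cnorm F) (cnorm G) := by
  induction h with
  | refl F => exact .refl _
  | symm _ ih => exact ih.symm
  | trans _ _ ih₁ ih₂ => exact ih₁.trans ih₂
  | add_congr _ _ ih₁ ih₂ =>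
    rw [cnorm_add, cnorm_add]
    exact sadd_congr (nf_cnorm _) (nf_cnorm _) (nf_cnorm _) (nf_cnorm _) ih₁ ih₂
  | mul_congr _ _ ih₁ ih₂ =>
    rw [cnorm_mul, cnorm_mul]
    exact smul_congr (nf_cnorm _) (nf_cnorm _) (nf_cnorm _) (nf_cnorm _) ih₁ ih₂
  | add_comm F G => exact acEq_sadd_comm _ _
  | add_assoc F G H => exact acEq_sadd_assoc (nf_cnorm F) (nf_cnorm G) (nf_cnorm H)
  | mul_comm F G => exact acEq_smul_comm _ _
  | mul_assoc F G H => exact acEq_smul_assoc (nf_cnorm F) (nf_cnorm G) (nf_cnorm H)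
  | add_zero F =>
    rw [cnorm_add, cnorm_const, sadd_const_zero (nf_cnorm F)]
    exact .refl _
  | mul_zero F =>
    rw [cnorm_mul, cnorm_const, smul_const_zero]
    exact .refl _
  | mul_one F =>
    rw [cnorm_mul, cnorm_const, smul_const_one (nf_cnorm F)]
    exact .refl _
  | const_add a b c h =>
    rw [cnorm_add, cnorm_const, cnorm_const, cnorm_const, sadd_const_const, ← h]
    exact .refl _
  | const_mul a b c h =>
    rw [cnorm_mul, cnorm_const, cnorm_const, cnorm_const, smul_const_const, ← h]
    exact .refl _

/-- With AC-completeness: the normal forms are inter-derivable in `P_f` without A6–A10.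
[folklore] -/
theorem mk_cnorm_eq_of_ucEq [Nontrivial 𝔽] {F G : PIFormula 𝔽 X} (h : UCEq F G) :
    mk (cnorm F) = mk (cnorm G) :=
  mk_eq_mk.2 (acEq_cnorm_of_ucEq h)

end Calculus

end ACStability

open Literature.Computability.AlgebraicComplexity in
/-- **Units and constants are absorbed by constant folding** (helper under stub S2″
`stub_proofsToACEquiv`, crux `RestorationQP`, rung S3⁗): over `ℂ`, formulas in the matrix variables
that are equal modulo associativity, commutativity, the unit laws A7–A9 and the constant equations A10
have constant-folding normal forms that are equal modulo associativity and commutativity, i.e.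
inter-derivable in `P_f(ℂ)` without A6–A10. [folklore] -/
theorem proofsToACEquiv_aux_constNorm : ∀ (n : ℕ) (F G : PIFormula ℂ (Fin n × Fin n)), ACStability.UCEq F G → (pfSystem ℂ (Fin n × Fin n)).Provable (ACStability.cnorm F) (ACStability.cnorm G) ⊤ (fun s => if s = PIAxiom.A6 ∨ s = PIAxiom.A7 ∨ s = PIAxiom.A8 ∨ s = PIAxiom.A9 ∨ s = PIAxiom.A10 then 0 else ⊤) := by
  intro n F G h
  exact ACStability.pfProvable_of_acEq (ACStability.acEq_cnorm_of_ucEq h)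

end Summit.ValiantsHypothesis.ValiantsHypothesis.Theorems

end
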